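import Summits.AnomalousDissipation.AnomalousDissipation.Theorems.SolenoidalFractalHomogenisationLagrangianStepFlatBilinearWindow
import Summits.AnomalousDissipation.AnomalousDissipation.Theorems.SolenoidalFractalHomogenisationLagrangianStepPairData
import Literature.Analysis.FluidPDE.PassiveVectorTensorModeEnergy
import Literature.Analysis.FluidPDE.PassiveVectorTensorDissipationDensity
import Literature.Analysis.FluidPDE.PassiveVectorTensorPropagatorEnergy
import Summits.AnomalousDissipation.AnomalousDissipation.Theorems.SolenoidalFractalHomogenisationLagrangianStepCellEnergyTDualLeak
import HarnessLib

/-!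
# K1L_D (stmt-AnomalousDissipation-27980), line «onelevel-design», brick Z7-E0: FLAT ENERGY TRACKING (helper; lead-k1l-onelevel-p1 g4)

Memo L9 §5: every route to the distortion transfer Z7 needs the forward-side dissipation in the N-currency; by the energy identity this is the
energy LOSS of the flat cell propagator on slow data, which follows MODEWISE from the diagonal window bound `abs_inner_window_sub_le_sum`
(p685480; exact class decoupling) and the modewise energy window of the carrier-free effective propagator:
`norm_sq_fcoeff_carrierFree_window` (`(1 − 8π²|hi'||k|²(t−s))‖𝓕x(k)‖² ≤ ‖𝓕(U s t x)(k)‖² ≤ ‖𝓕x(k)‖²` at EVERY `t`: one-mode energy identity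
a.e. + weak continuity of the orbit), `fcoeff_pairTest` / `norm_fcoeff_le_of_diagonal` (testing with the `{ℓ,−ℓ}`-part of the error gives the
modewise error), `norm_sq_sub_norm_sq_le_sum` (energy algebra), and **`flatEnergyTracking`**:
`‖x‖² − ‖Um1 (jr) s' x‖² ≤ Σ_{ℓ∈S} min(1, 8π²(kbar_m·hi)|ℓ|²(s'−jr) + 4√2·err_ℓ)‖𝓕x(ℓ)‖²` (`8π² kbar_m hi |ℓ|² = (hi/lo)·rate_ℓ`).
NOT a proof of §9z, of the crux, or of AD; rung F-D1.A0.
-/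

set_option linter.dupNamespace false  -- the summit-side namespace `Summit.AnomalousDissipation.AnomalousDissipation.…` repeats a component by design (D-0017)

noncomputable section

namespace Summit.AnomalousDissipation.AnomalousDissipation.Theorems.SolenoidalFractalHomogenisation.LagrangianStep.FlatWindow

open Literature.Analysis Literature.Analysis.FluidPDE Literature.Analysis.FunctionSpaces
open MeasureTheory Set Filter Complex UnitAddTorus
open scoped ENNReal NNReal InnerProductSpace
open OneLevelSplit
open Literature.Analysis.FluidPDE.LatticeShear (LagrangianLatticeCarrier LatticeWord)
open Summit.AnomalousDissipation.AnomalousDissipation.Theorems.SolenoidalFractalHomogenisation.LagrangianRenormalisationStep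
  (cellVisc_pos')

variable {k : ℕ}

/-! ## §1 The modewise energy window of a carrier-free propagator -/

omit k in
/-- The Fourier coefficients of the zero field vanish. -/
theorem fcoeff_const_zero (k' : Fin 3 → ℤ) :
    mFourierCoeff (EuclideanSpace.complexify ∘ fun _ : UnitAddTorus (Fin 3) => (0 : EuclideanSpace ℝ (Fin 3))) k' = 0 := by
  have h : (EuclideanSpace.complexify ∘ fun _ : UnitAddTorus (Fin 3) => (0 : EuclideanSpace ℝ (Fin 3)))
      = fun _ => (0 : EuclideanSpace ℂ (Fin 3)) := by funext x; simp
  rw [h]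
  simp [mFourierCoeff]

/-- **Modewise energy window of a carrier-free propagator, at every time.**  For a propagator `U` of the carrier-free problem with tensor
`𝔸 ∈ NearIso lo' hi'`, `0 < lo'`, divergence-free `x ∈ V2`, `0 ≤ s ≤ t ≤ T₀`, `s < T₀` and every frequency `k'`:
`(1 − 8π²|hi'|·|k'|²·(t−s))‖𝓕x(k')‖² ≤ ‖𝓕(U s t x)(k')‖² ≤ ‖𝓕x(k')‖²`
(one-mode energy identity `PassiveVectorTensorModeEnergy.ae_sq_norm_mFourierCoeff_eq` for a Lions solution representing the orbit, coercivity /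
upper bound of `Re⟪z, T_𝔸 z⟫` on transversal `z`, and weak continuity of the orbit to reach EVERY `t`). -/
theorem norm_sq_fcoeff_carrierFree_window {T₀ : ℝ} {𝔸 : Torus.Visc4 (Fin 3)} {lo' hi' : ℝ} (h𝔸 : Torus.NearIso 𝔸 lo' hi') (hlo' : 0 < lo')
    {U : ℝ → ℝ → (V2 →L[ℝ] V2)}
    (hU : Torus.IsPropagator T₀ (fun (_ : ℝ) (_ : UnitAddTorus (Fin 3)) => (0 : EuclideanSpace ℝ (Fin 3))) 𝔸 U)
    {s t : ℝ} (hs : 0 ≤ s) (hst : s ≤ t) (htT : t ≤ T₀) (hsT : s < T₀) (x : V2) (hx : Torus.IsWeaklyDivFree (x : VF)) (k' : Fin 3 → ℤ) :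
    (1 - 8 * Real.pi ^ 2 * |hi'| * Torus.freqNormSq k' * (t - s)) * ‖mFourierCoeff (EuclideanSpace.complexify ∘ ⇑x) k'‖ ^ 2
        ≤ ‖mFourierCoeff (EuclideanSpace.complexify ∘ ⇑(U s t x)) k'‖ ^ 2 ∧
      ‖mFourierCoeff (EuclideanSpace.complexify ∘ ⇑(U s t x)) k'‖ ^ 2 ≤ ‖mFourierCoeff (EuclideanSpace.complexify ∘ ⇑x) k'‖ ^ 2 := by
  set L : ℝ := T₀ - s with hL
  have hL0 : 0 < L := by rw [hL]; linarith
  -- a Lions weak solution of the carrier-free problem from `x` on `[s, T₀)`, representing the orbit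
  have hb : MemLp (Torus.stLift (fun (_ : ℝ) (_ : UnitAddTorus (Fin 3)) => (0 : EuclideanSpace ℝ (Fin 3)))) ∞
      (volume.restrict (Ioo 0 L ×ˢ (univ : Set (EuclideanSpace ℝ (Fin 3))))) := memLp_top_const 0
  have hbdiv : ∀ᵐ τ ∂(volume.restrict (Ioo (0:ℝ) L)),
      Torus.IsWeaklyDivFree ((fun (_ : ℝ) (_ : UnitAddTorus (Fin 3)) => (0 : EuclideanSpace ℝ (Fin 3))) τ) :=
    ae_of_all _ fun τ θ hθ => by simp
  obtain ⟨v, hv⟩ := Torus.exists_isWeakTensorPassiveVectorOn hL0 h𝔸 hlo' hb hbdiv (Lp.memLp x) hx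
  have hrepr := hU.repr s hs hsT (x : VF) (Lp.memLp x) hx v (by simpa [hL] using hv)
  rw [Lp.toLp_coeFn] at hrepr
  set X₀ : EuclideanSpace ℂ (Fin 3) := mFourierCoeff (EuclideanSpace.complexify ∘ ⇑x) k' with hX₀
  set c : ℝ := 8 * Real.pi ^ 2 * |hi'| * Torus.freqNormSq k' with hc
  have hc0 : 0 ≤ c := by rw [hc]; have := Torus.freqNormSq_nonneg k'; positivity
  -- the one-mode energy identity, flux terms vanish (no carrier)
  have hid := hv.ae_sq_norm_mFourierCoeff_eq (Lp.memLp x) hx k'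
  have hflux1 : ∀ τ (j : Fin 3), mFourierCoeff (EuclideanSpace.complexify ∘ fun y =>
      ((fun (_ : ℝ) (_ : UnitAddTorus (Fin 3)) => (0 : EuclideanSpace ℝ (Fin 3))) τ y) j • v τ y) k' = 0 := by
    intro τ j
    have : (fun y : UnitAddTorus (Fin 3) => ((fun (_ : ℝ) (_ : UnitAddTorus (Fin 3)) => (0 : EuclideanSpace ℝ (Fin 3))) τ y) j • v τ y)
        = fun _ => 0 := by funext y; simp
    rw [this, fcoeff_const_zero]
  have hflux2 : ∀ τ (j : Fin 3), mFourierCoeff (EuclideanSpace.complexify ∘ fun y =>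
      v τ y j • (fun (_ : ℝ) (_ : UnitAddTorus (Fin 3)) => (0 : EuclideanSpace ℝ (Fin 3))) τ y) k' = 0 := by
    intro τ j
    have : (fun y : UnitAddTorus (Fin 3) => v τ y j • (fun (_ : ℝ) (_ : UnitAddTorus (Fin 3)) => (0 : EuclideanSpace ℝ (Fin 3))) τ y)
        = fun _ => 0 := by funext y; simp
    rw [this, fcoeff_const_zero]
  set g : ℝ → ℝ := fun σ => ((-(4 * Real.pi ^ 2 : ℝ) : ℂ) *
      ⟪mFourierCoeff (EuclideanSpace.complexify ∘ v σ) k', Torus.symbT 𝔸 k' (mFourierCoeff (EuclideanSpace.complexify ∘ v σ) k')⟫_ℂ).re with hg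
  have hid' : ∀ᵐ τ ∂(volume.restrict (Ioo 0 L)),
      ‖mFourierCoeff (EuclideanSpace.complexify ∘ v τ) k'‖ ^ 2 = ‖X₀‖ ^ 2 + 2 * ∫ σ in Ioc 0 τ, g σ := by
    filter_upwards [hid] with τ hτ
    rw [hτ]
    congr 2
    refine integral_congr_ae (ae_of_all _ fun σ => ?_)
    simp only [hflux1, hflux2, inner_zero_left, mul_zero, Finset.sum_const_zero, add_zero, hg]
  have htrans := hv.ae_sum_mul_mFourierCoeff_eq_zero k'
  have hgσ : ∀ σ, g σ = -(4 * Real.pi ^ 2) * (⟪mFourierCoeff (EuclideanSpace.complexify ∘ v σ) k',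
      Torus.symbT 𝔸 k' (mFourierCoeff (EuclideanSpace.complexify ∘ v σ) k')⟫_ℂ).re := fun σ => by
    simp only [hg]
    rw [← Complex.ofReal_neg, Complex.re_ofReal_mul]
  have hg_le : ∀ᵐ σ ∂(volume.restrict (Ioo 0 L)), g σ ≤ 0 := by
    filter_upwards [htrans] with σ hσ
    have hlo := Torus.lo_mul_le_re_inner_symbT h𝔸 hσ
    have h0 : 0 ≤ (⟪mFourierCoeff (EuclideanSpace.complexify ∘ v σ) k',
        Torus.symbT 𝔸 k' (mFourierCoeff (EuclideanSpace.complexify ∘ v σ) k')⟫_ℂ).re :=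
      le_trans (mul_nonneg hlo'.le (mul_nonneg (Torus.freqNormSq_nonneg k') (sq_nonneg _))) hlo
    rw [hgσ]
    nlinarith [Real.pi_pos, sq_nonneg Real.pi]
  have hg_ge : ∀ᵐ σ ∂(volume.restrict (Ioo 0 L)),
      -(c / 2) * ‖mFourierCoeff (EuclideanSpace.complexify ∘ v σ) k'‖ ^ 2 ≤ g σ := by
    filter_upwards [htrans] with σ hσ
    have hhi := Torus.IsWeakTensorPassiveVectorOn.re_inner_symbT_le_abs_hi_mul h𝔸 hσ
    rw [hgσ, hc]
    nlinarith [Real.pi_pos, sq_nonneg Real.pi, hhi]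
  have hgi : IntegrableOn g (Ioo 0 L) volume := by
    have h1 := (hv.integrableOn_inner_symbT k').const_mul ((-(4 * Real.pi ^ 2 : ℝ) : ℂ))
    exact h1.re
  have hupper : ∀ᵐ τ ∂(volume.restrict (Ioo 0 L)), ‖mFourierCoeff (EuclideanSpace.complexify ∘ v τ) k'‖ ^ 2 ≤ ‖X₀‖ ^ 2 := by
    filter_upwards [hid', ae_restrict_mem measurableSet_Ioo] with τ hτ hτm
    rw [hτ]
    have hsub : Ioc 0 τ ⊆ Ioo 0 L := fun σ hσ => ⟨hσ.1, lt_of_le_of_lt hσ.2 hτm.2⟩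
    have : ∫ σ in Ioc 0 τ, g σ ≤ 0 :=
      integral_nonpos_of_ae (ae_restrict_of_ae_restrict_of_subset hsub hg_le)
    linarith
  have hlower : ∀ᵐ τ ∂(volume.restrict (Ioo 0 L)),
      (1 - c * τ) * ‖X₀‖ ^ 2 ≤ ‖mFourierCoeff (EuclideanSpace.complexify ∘ v τ) k'‖ ^ 2 := by
    filter_upwards [hid', ae_restrict_mem measurableSet_Ioo] with τ hτ hτm
    rw [hτ]
    have hsub : Ioc 0 τ ⊆ Ioo 0 L := fun σ hσ => ⟨hσ.1, lt_of_le_of_lt hσ.2 hτm.2⟩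
    have hbound : ∀ᵐ σ ∂(volume.restrict (Ioc 0 τ)), -(c / 2) * ‖X₀‖ ^ 2 ≤ g σ := by
      have h1 := ae_restrict_of_ae_restrict_of_subset hsub hg_ge
      have h2 := ae_restrict_of_ae_restrict_of_subset hsub hupper
      filter_upwards [h1, h2] with σ h1σ h2σ
      have : -(c / 2) * ‖X₀‖ ^ 2 ≤ -(c / 2) * ‖mFourierCoeff (EuclideanSpace.complexify ∘ v σ) k'‖ ^ 2 := by nlinarith
      exact this.trans h1σ
    have hint : ∫ σ in Ioc 0 τ, -(c / 2) * ‖X₀‖ ^ 2 ≤ ∫ σ in Ioc 0 τ, g σ :=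
      integral_mono_ae (integrable_const _) (hgi.mono_set hsub) hbound
    rw [setIntegral_const, smul_eq_mul, Real.volume_real_Ioc_of_le hτm.1.le, sub_zero] at hint
    nlinarith
  have horbit : ∀ᵐ τ ∂(volume.restrict (Ioo 0 L)),
      mFourierCoeff (EuclideanSpace.complexify ∘ ⇑(U s (s + τ) x)) k' = mFourierCoeff (EuclideanSpace.complexify ∘ v τ) k' := by
    filter_upwards [hrepr] with τ hτ
    obtain ⟨hm, he⟩ := hτ
    rw [← he]
    exact Torus.mFourierCoeff_congr_ae (Filter.EventuallyEq.fun_comp (MemLp.coeFn_toLp _) EuclideanSpace.complexify) k'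
  -- continuity of `τ ↦ 2‖𝓕(U s (s+τ) x)(k')‖²` on `[0, L]`
  have hmaps : MapsTo (fun τ : ℝ => s + τ) (Icc 0 L) (Icc s T₀) := fun τ hτ => ⟨by linarith [hτ.1], by rw [hL] at hτ; linarith [hτ.2]⟩
  have hF : ∀ z : V2, ContinuousOn (fun τ => ⟪U s (s + τ) x, z⟫_ℝ) (Icc 0 L) := fun z =>
    (hU.continuousOn s hs hsT.le x z).comp (continuous_const.add continuous_id).continuousOn hmaps
  have hf : ContinuousOn (fun τ => 2 * ‖mFourierCoeff (EuclideanSpace.complexify ∘ ⇑(U s (s + τ) x)) k'‖ ^ 2) (Icc 0 L) := by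
    have h := PropagatorSymm.continuousOn_sum_norm_sq_modeCoeff hF k'
    refine h.congr fun τ _ => ?_
    simp only [sum_norm_sq_modeCoeff_coe]
  have hcu : ContinuousOn (fun _ : ℝ => 2 * ‖X₀‖ ^ 2) (Icc 0 L) := continuousOn_const
  have hcl : ContinuousOn (fun τ : ℝ => 2 * ((1 - c * τ) * ‖X₀‖ ^ 2)) (Icc 0 L) :=
    (continuous_const.mul ((continuous_const.sub (continuous_const.mul continuous_id)).mul continuous_const)).continuousOn
  have hae_u : ∀ᵐ τ ∂(volume.restrict (Ioo 0 L)),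
      2 * ‖mFourierCoeff (EuclideanSpace.complexify ∘ ⇑(U s (s + τ) x)) k'‖ ^ 2 ≤ 2 * ‖X₀‖ ^ 2 := by
    filter_upwards [horbit, hupper] with τ h1 h2
    rw [h1]; linarith
  have hae_l : ∀ᵐ τ ∂(volume.restrict (Ioo 0 L)),
      2 * ((1 - c * τ) * ‖X₀‖ ^ 2) ≤ 2 * ‖mFourierCoeff (EuclideanSpace.complexify ∘ ⇑(U s (s + τ) x)) k'‖ ^ 2 := by
    filter_upwards [horbit, hlower] with τ h1 h2
    rw [h1]; linarith
  have hU' := Torus.le_on_Icc_of_ae_le_of_continuousOn₂ hL0 hf hcu hae_u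
  have hL' := Torus.le_on_Icc_of_ae_le_of_continuousOn₂ hL0 hcl hf hae_l
  have hτ0 : t - s ∈ Icc 0 L := ⟨by linarith, by rw [hL]; linarith⟩
  have e : s + (t - s) = t := by ring
  have h1 := hU' _ hτ0
  have h2 := hL' _ hτ0
  simp only [e] at h1 h2
  constructor
  · rw [hc] at h2; nlinarith [h2]
  · linarith

/-! ## §2 Testing a diagonal bilinear bound with the `{ℓ, −ℓ}`-part of the error -/

omit k in
/-- **The pair test vector.**  For `δ ∈ V2` and `ℓ ≠ 0`, the `V2` element `toLp (realTrigPoly {ℓ} (2•𝓕δ(ℓ)))` has Fourier coefficients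
`𝓕δ(k')` for `k' ∈ {ℓ, −ℓ}` and `0` otherwise. -/
theorem fcoeff_pairTest (δ : V2) {ℓ : Fin 3 → ℤ} (hℓ : ℓ ≠ 0) (k' : Fin 3 → ℤ) :
    mFourierCoeff (EuclideanSpace.complexify ∘
        ⇑((Torus.memLp_realTrigPoly {ℓ} (fun _ => (2:ℂ) • mFourierCoeff (EuclideanSpace.complexify ∘ ⇑δ) ℓ) 2).toLp _)) k'
      = if k' = ℓ ∨ k' = -ℓ then mFourierCoeff (EuclideanSpace.complexify ∘ ⇑δ) k' else 0 := by
  rw [Torus.mFourierCoeff_congr_ae (Filter.EventuallyEq.fun_comp (MemLp.coeFn_toLp _) EuclideanSpace.complexify) k',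
    Torus.mFourierCoeff_realTrigPoly_singleton]
  have hℓℓ : ℓ ≠ -ℓ := CellEnergyT.ne_neg_of_ne_zero hℓ
  by_cases h1 : k' = ℓ
  · subst h1
    rw [if_pos rfl, if_neg hℓℓ, EuclideanSpace.conjVec_zero, add_zero, smul_smul, if_pos (Or.inl rfl)]
    norm_num
  · by_cases h2 : k' = -ℓ
    · subst h2
      rw [if_neg h1, if_pos rfl, zero_add, EuclideanSpace.conjVec_smul, smul_smul, map_ofNat, if_pos (Or.inr rfl)]
      have hsymm := Torus.isConjSymm_mFourierCoeff (integrable_coe_V2 δ) ℓ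
      simp only at hsymm
      rw [hsymm]; norm_num
    · rw [if_neg h1, if_neg h2, EuclideanSpace.conjVec_zero, add_zero, smul_zero, if_neg (not_or.2 ⟨h1, h2⟩)]

omit k in
/-- Real fields: `‖𝓕v(−k)‖ = ‖𝓕v(k)‖` on `V2`. -/
theorem norm_fcoeff_neg (v : V2) (k' : Fin 3 → ℤ) :
    ‖mFourierCoeff (EuclideanSpace.complexify ∘ ⇑v) (-k')‖ = ‖mFourierCoeff (EuclideanSpace.complexify ∘ ⇑v) k'‖ := by
  have hsymm := Torus.isConjSymm_mFourierCoeff (integrable_coe_V2 v) k'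
  simp only at hsymm
  rw [hsymm, EuclideanSpace.norm_conjVec]

omit k in
/-- **A diagonal bilinear bound tested with the pair test vector gives the modewise bound**: if
`|⟪δ, y_ℓ⟫| ≤ Σ_{k∈S} e_k ‖𝓕x(k)‖ ‖𝓕y_ℓ(k)‖` for the pair test vector `y_ℓ` of `δ` (`ℓ, −ℓ ∈ S`, `e_{−ℓ} = e_ℓ ≥ 0`), then
`‖𝓕δ(ℓ)‖ ≤ e_ℓ ‖𝓕x(ℓ)‖`. -/
theorem norm_fcoeff_le_of_diagonal (S : Finset (Fin 3 → ℤ)) (x δ : V2) {ℓ : Fin 3 → ℤ} (hℓ : ℓ ≠ 0) (hℓS : ℓ ∈ S) (hℓS' : -ℓ ∈ S)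
    (e : (Fin 3 → ℤ) → ℝ) (he : e (-ℓ) = e ℓ) (he0 : 0 ≤ e ℓ)
    (hdiag : |⟪δ, (Torus.memLp_realTrigPoly {ℓ} (fun _ => (2:ℂ) • mFourierCoeff (EuclideanSpace.complexify ∘ ⇑δ) ℓ) 2).toLp _⟫_ℝ|
      ≤ ∑ k' ∈ S, e k' * ‖mFourierCoeff (EuclideanSpace.complexify ∘ ⇑x) k'‖ *
          ‖mFourierCoeff (EuclideanSpace.complexify ∘
            ⇑((Torus.memLp_realTrigPoly {ℓ} (fun _ => (2:ℂ) • mFourierCoeff (EuclideanSpace.complexify ∘ ⇑δ) ℓ) 2).toLp _)) k'‖) :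
    ‖mFourierCoeff (EuclideanSpace.complexify ∘ ⇑δ) ℓ‖ ≤ e ℓ * ‖mFourierCoeff (EuclideanSpace.complexify ∘ ⇑x) ℓ‖ := by
  set y : V2 := (Torus.memLp_realTrigPoly {ℓ} (fun _ => (2:ℂ) • mFourierCoeff (EuclideanSpace.complexify ∘ ⇑δ) ℓ) 2).toLp _ with hy
  have hℓℓ : ℓ ≠ -ℓ := CellEnergyT.ne_neg_of_ne_zero hℓ
  have hyc : ∀ k', mFourierCoeff (EuclideanSpace.complexify ∘ ⇑y) k'
      = if k' = ℓ ∨ k' = -ℓ then mFourierCoeff (EuclideanSpace.complexify ∘ ⇑δ) k' else 0 := fcoeff_pairTest δ hℓ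
  have hysupp : ∀ k', k' ∉ ({ℓ, -ℓ} : Finset (Fin 3 → ℤ)) → mFourierCoeff (EuclideanSpace.complexify ∘ ⇑y) k' = 0 := by
    intro k' hk'
    rw [Finset.mem_insert, Finset.mem_singleton] at hk'
    rw [hyc, if_neg hk']
  set a : ℝ := ‖mFourierCoeff (EuclideanSpace.complexify ∘ ⇑δ) ℓ‖ with ha
  set b : ℝ := ‖mFourierCoeff (EuclideanSpace.complexify ∘ ⇑x) ℓ‖ with hb
  -- left-hand side: `⟪δ, y⟫ = 2a²`
  have hL : ⟪δ, y⟫_ℝ = 2 * a ^ 2 := by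
    rw [inner_eq_sum_of_support {ℓ, -ℓ} δ y hysupp, Finset.sum_pair hℓℓ, hyc, hyc, if_pos (Or.inl rfl), if_pos (Or.inr rfl)]
    have h1 : ∀ z : EuclideanSpace ℂ (Fin 3), (inner ℂ z z).re = ‖z‖ ^ 2 := fun z => by
      rw [← inner_self_eq_norm_sq (𝕜 := ℂ) z]; rfl
    rw [h1, h1, norm_fcoeff_neg, ← ha]; ring
  -- right-hand side: `2 e_ℓ b a`
  have hR : ∑ k' ∈ S, e k' * ‖mFourierCoeff (EuclideanSpace.complexify ∘ ⇑x) k'‖ * ‖mFourierCoeff (EuclideanSpace.complexify ∘ ⇑y) k'‖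
      = 2 * (e ℓ * b * a) := by
    have hsub : ({ℓ, -ℓ} : Finset (Fin 3 → ℤ)) ⊆ S := by
      intro k' hk'
      rw [Finset.mem_insert, Finset.mem_singleton] at hk'
      rcases hk' with rfl | rfl
      · exact hℓS
      · exact hℓS'
    rw [← Finset.sum_subset hsub (fun k' _ hk' => by rw [hysupp k' hk', norm_zero, mul_zero]), Finset.sum_pair hℓℓ,
      hyc, hyc, if_pos (Or.inl rfl), if_pos (Or.inr rfl), norm_fcoeff_neg, norm_fcoeff_neg, he, ← ha, ← hb]
    ring
  rw [hL, hR, abs_of_nonneg (by positivity)] at hdiag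
  have ha0 : 0 ≤ a := norm_nonneg _
  by_cases hz : a = 0
  · rw [hz]; exact mul_nonneg he0 (norm_nonneg _)
  · have hpos : 0 < a := lt_of_le_of_ne ha0 (Ne.symm hz)
    have : a * a ≤ e ℓ * b * a := by nlinarith
    exact le_of_mul_le_mul_right this hpos

omit k in
/-- **The energy algebra.**  If on the support `S` of the datum `x` the "effective" output `u` contracts modewise with loss at most `d_ℓ`
(`(1 − d_ℓ)‖𝓕x(ℓ)‖² ≤ ‖𝓕u(ℓ)‖² ≤ ‖𝓕x(ℓ)‖²`) and the true output `w` tracks it modewise (`‖𝓕(w − u)(ℓ)‖ ≤ e_ℓ‖𝓕x(ℓ)‖`), then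
`‖x‖² − ‖w‖² ≤ Σ_{ℓ∈S} min(1, d_ℓ + 2e_ℓ)‖𝓕x(ℓ)‖²`. -/
theorem norm_sq_sub_norm_sq_le_sum (S : Finset (Fin 3 → ℤ)) (x u w : V2)
    (hxS : ∀ k', k' ∉ S → mFourierCoeff (EuclideanSpace.complexify ∘ ⇑x) k' = 0)
    (d e : (Fin 3 → ℤ) → ℝ)
    (hu_le : ∀ ℓ ∈ S, ‖mFourierCoeff (EuclideanSpace.complexify ∘ ⇑u) ℓ‖ ^ 2 ≤ ‖mFourierCoeff (EuclideanSpace.complexify ∘ ⇑x) ℓ‖ ^ 2)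
    (hu_ge : ∀ ℓ ∈ S, (1 - d ℓ) * ‖mFourierCoeff (EuclideanSpace.complexify ∘ ⇑x) ℓ‖ ^ 2 ≤ ‖mFourierCoeff (EuclideanSpace.complexify ∘ ⇑u) ℓ‖ ^ 2)
    (hδ : ∀ ℓ ∈ S, ‖mFourierCoeff (EuclideanSpace.complexify ∘ ⇑(w - u)) ℓ‖ ≤ e ℓ * ‖mFourierCoeff (EuclideanSpace.complexify ∘ ⇑x) ℓ‖) :
    ‖x‖ ^ 2 - ‖w‖ ^ 2 ≤ ∑ ℓ ∈ S, min 1 (d ℓ + 2 * e ℓ) * ‖mFourierCoeff (EuclideanSpace.complexify ∘ ⇑x) ℓ‖ ^ 2 := by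
  have hx : ‖x‖ ^ 2 = ∑ ℓ ∈ S, ‖mFourierCoeff (EuclideanSpace.complexify ∘ ⇑x) ℓ‖ ^ 2 := norm_sq_eq_sum_of_support S x hxS
  have hw : ∑ ℓ ∈ S, ‖mFourierCoeff (EuclideanSpace.complexify ∘ ⇑w) ℓ‖ ^ 2 ≤ ‖w‖ ^ 2 :=
    sum_le_hasSum S (fun ℓ _ => sq_nonneg _) (hasSum_norm_sq_fcoeff w)
  have hterm : ∀ ℓ ∈ S, ‖mFourierCoeff (EuclideanSpace.complexify ∘ ⇑x) ℓ‖ ^ 2 - ‖mFourierCoeff (EuclideanSpace.complexify ∘ ⇑w) ℓ‖ ^ 2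
      ≤ min 1 (d ℓ + 2 * e ℓ) * ‖mFourierCoeff (EuclideanSpace.complexify ∘ ⇑x) ℓ‖ ^ 2 := by
    intro ℓ hℓ
    set X := ‖mFourierCoeff (EuclideanSpace.complexify ∘ ⇑x) ℓ‖ with hX
    set Uℓ := ‖mFourierCoeff (EuclideanSpace.complexify ∘ ⇑u) ℓ‖ with hU
    set Wℓ := ‖mFourierCoeff (EuclideanSpace.complexify ∘ ⇑w) ℓ‖ with hW
    set Dℓ := ‖mFourierCoeff (EuclideanSpace.complexify ∘ ⇑(w - u)) ℓ‖ with hD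
    have hX0 : 0 ≤ X := norm_nonneg _
    have hU0 : 0 ≤ Uℓ := norm_nonneg _
    have hW0 : 0 ≤ Wℓ := norm_nonneg _
    have hD0 : 0 ≤ Dℓ := norm_nonneg _
    -- `‖û‖ ≤ ‖ŵ‖ + ‖δ̂‖`
    have htri : Uℓ ≤ Wℓ + Dℓ := by
      have e1 : mFourierCoeff (EuclideanSpace.complexify ∘ ⇑u) ℓ
          = mFourierCoeff (EuclideanSpace.complexify ∘ ⇑w) ℓ - mFourierCoeff (EuclideanSpace.complexify ∘ ⇑(w - u)) ℓ := by
        rw [fcoeff_sub]; abel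
      rw [hU, e1]
      exact norm_sub_le _ _
    have h1 : Uℓ ^ 2 - 2 * Uℓ * Dℓ ≤ Wℓ ^ 2 := by
      by_cases hc : Dℓ ≤ Uℓ
      · nlinarith [mul_nonneg (sub_nonneg.2 (by linarith : Uℓ - Dℓ ≤ Wℓ)) (by linarith : 0 ≤ Wℓ + (Uℓ - Dℓ))]
      · push Not at hc
        nlinarith
    have h2 : Uℓ ≤ X := by
      have := hu_le ℓ hℓ
      rw [← hU, ← hX] at this
      exact (pow_le_pow_iff_left₀ hU0 hX0 two_ne_zero).1 this
    have h3 := hu_ge ℓ hℓ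
    have h4 := hδ ℓ hℓ
    rw [← hU, ← hX] at h3
    rw [← hD, ← hX] at h4
    have hA : X ^ 2 - Wℓ ^ 2 ≤ (d ℓ + 2 * e ℓ) * X ^ 2 := by nlinarith [mul_le_mul h2 h4 hD0 hX0]
    have hB : X ^ 2 - Wℓ ^ 2 ≤ 1 * X ^ 2 := by nlinarith
    rcases min_choice (1:ℝ) (d ℓ + 2 * e ℓ) with hm | hm <;> rw [hm] <;> assumption
  calc ‖x‖ ^ 2 - ‖w‖ ^ 2 ≤ ∑ ℓ ∈ S, ‖mFourierCoeff (EuclideanSpace.complexify ∘ ⇑x) ℓ‖ ^ 2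
        - ∑ ℓ ∈ S, ‖mFourierCoeff (EuclideanSpace.complexify ∘ ⇑w) ℓ‖ ^ 2 := by rw [hx]; linarith
    _ = ∑ ℓ ∈ S, (‖mFourierCoeff (EuclideanSpace.complexify ∘ ⇑x) ℓ‖ ^ 2 - ‖mFourierCoeff (EuclideanSpace.complexify ∘ ⇑w) ℓ‖ ^ 2) := by
        rw [Finset.sum_sub_distrib]
    _ ≤ ∑ ℓ ∈ S, min 1 (d ℓ + 2 * e ℓ) * ‖mFourierCoeff (EuclideanSpace.complexify ∘ ⇑x) ℓ‖ ^ 2 := Finset.sum_le_sum hterm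


/-! ## §3 Z7-E0: flat energy tracking -/

/-- **Z7-E0 — FLAT ENERGY TRACKING.**  In the setting of `abs_inner_window_sub_le_sum` (the flat pair on one grid window, (V) read
modewise), for `S`-supported divergence-free `x` (`S = freqBall(Lc/2) ∖ {0}`):
`‖x‖² − ‖Um1 (jr) s' x‖² ≤ Σ_{ℓ∈S} min(1, 8π²(kbar_m·hi)|ℓ|²(s'−jr) + 2·(2√2·err_ℓ(a(s'−jr))))·‖𝓕x(ℓ)‖²`
— the slow datum loses at most the (effective-rate + tracking-error) fraction of its energy, MODEWISE; `8π² kbar_m hi |ℓ|² = (hi/lo)·rate_ℓ`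
in the N-currency of §9z.  Hence also `‖P_{Sᶜ} Um1 x‖²` (the corrector energy) is bounded by the same sum. -/
theorem flatEnergyTracking (E : LagrangianLatticeCarrier k) (hL : E.LPermissible) {W : LatticeWord k} {M : ℝ} {hM : 0 < M}
    (hdes : E.design = W.stretch M hM) {c : ℝ} (hgain : E.gain = c) (m : ℕ)
    {Φ : ℝ → FluidPDE.Torus.Visc4 (Fin 3) → FluidPDE.Torus.Visc4 (Fin 3)} {lo hi Λ β σ C ν₀ K : ℝ}
    (hV : SlowVectorClauseF W M hM c Φ lo hi Λ β σ C ν₀ K) (hΛ : 1 ≤ Λ) (hlo : 0 < lo) (hhi : lo ≤ hi) (hc : 0 < c) (hC : 0 ≤ C)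
    (hν₀ : E.cellVisc (m + 1) < ν₀)
    {S : FluidPDE.Torus.Visc4 (Fin 3)} (hSo : FluidPDE.Torus.OddSmall S β) (hSn : FluidPDE.Torus.NearIso S lo hi)
    (hΦSn : FluidPDE.Torus.NearIso (Φ (E.cellVisc (m + 1)) S) lo hi)
    {Um Um1 : ℝ → ℝ → (V2 →L[ℝ] V2)}
    (hUm : FluidPDE.Torus.IsPropagator 1 (fun (_ : ℝ) (_ : UnitAddTorus (Fin 3)) => (0 : EuclideanSpace ℝ (Fin 3)))
      (E.kbar m • renormStep (Φ (E.cellVisc (m + 1))) (E.gain / E.cellVisc (m + 1) ^ 2) S) Um)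
    (hUm1 : FluidPDE.Torus.IsPropagator 1 (E.toFractalCarrierData.level (m + 1)) (E.kbar (m + 1) • S) Um1)
    (Lc : ℕ) (hLcN : 2 * (Lc / 2) < E.N (m + 1)) (hscale : ((Lc / 2 : ℕ) : ℝ) * (⌈K / E.cellVisc (m + 1)⌉₊ : ℝ) ≤ E.N (m + 1))
    (j : ℕ) {s' : ℝ} (h1 : (j : ℝ) * E.refresh (m + 1) < s') (h3 : s' ≤ 1) (x : V2)
    (hxS : ∀ k', k' ∉ (Torus.freqBall (Lc / 2)).erase 0 → mFourierCoeff (EuclideanSpace.complexify ∘ ⇑x) k' = 0)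
    (hxdiv : Torus.IsWeaklyDivFree (x : VF)) :
    ‖x‖ ^ 2 - ‖Um1 ((j : ℝ) * E.refresh (m + 1)) s' x‖ ^ 2
      ≤ ∑ ℓ ∈ (Torus.freqBall (Lc / 2)).erase 0,
          min 1 (8 * Real.pi ^ 2 * (E.kbar m * hi) * Torus.freqNormSq ℓ * (s' - (j : ℝ) * E.refresh (m + 1))
            + 2 * (2 * Real.sqrt 2 * (C * (C * (E.cellVisc (m + 1) ^ σ + (‖Torus.latticeVec ℓ‖ * (⌈K / E.cellVisc (m + 1)⌉₊ : ℝ) / E.N (m + 1)) ^ σ)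
              * min 1 ((8 * Real.pi ^ 2 * ‖Torus.latticeVec ℓ‖ ^ 2 * (hi * Λ) * (E.cellVisc (m + 1) + c / E.cellVisc (m + 1)) / (E.N (m + 1) : ℝ) ^ 2) * (E.a (m + 1) * (s' - (j : ℝ) * E.refresh (m + 1))))
            + (8 * Real.pi ^ 2 * ‖Torus.latticeVec ℓ‖ ^ 2 * (hi * Λ) * (E.cellVisc (m + 1) + c / E.cellVisc (m + 1)) / (E.N (m + 1) : ℝ) ^ 2)
              * (M * W.period / E.cellVisc (m + 1))))))
          * ‖mFourierCoeff (EuclideanSpace.complexify ∘ ⇑x) ℓ‖ ^ 2 := by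
  set s : ℝ := (j : ℝ) * E.refresh (m + 1) with hs_def
  have hs0 : 0 ≤ s := mul_nonneg (Nat.cast_nonneg _) (E.refresh_pos _).le
  have hs1 : s < 1 := lt_of_lt_of_le h1 h3
  have hν := cellVisc_pos' E.toFractalCarrierData (m + 1)
  have hg : 0 ≤ E.gain / E.cellVisc (m + 1) ^ 2 := div_nonneg E.gain_pos.le (sq_nonneg _)
  have h𝔸0 : FluidPDE.Torus.NearIso (E.kbar m • renormStep (Φ (E.cellVisc (m + 1))) (E.gain / E.cellVisc (m + 1) ^ 2) S)
      (E.kbar m * lo) (E.kbar m * hi) := (WindowDuality.nearIso_renormStep' hSn hΦSn hg).smul (E.kbar_pos m).le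
  have hlo0 : 0 < E.kbar m * lo := mul_pos (E.kbar_pos _) hlo
  have hhi0 : 0 ≤ E.kbar m * hi := mul_nonneg (E.kbar_pos _).le (hlo.le.trans hhi)
  -- the effective output: modewise window
  have hu := fun ℓ => norm_sq_fcoeff_carrierFree_window h𝔸0 hlo0 hUm hs0 h1.le h3 hs1 x hxdiv ℓ
  refine norm_sq_sub_norm_sq_le_sum ((Torus.freqBall (Lc / 2)).erase 0) x (Um s s' x) (Um1 s s' x) hxS _ _
    (fun ℓ _ => (hu ℓ).2) (fun ℓ _ => ?_) (fun ℓ hℓ => ?_)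
  · have h := (hu ℓ).1
    rwa [abs_of_nonneg hhi0] at h
  · -- the modewise tracking error from the diagonal window bound
    obtain ⟨hℓ0, hℓB⟩ := Finset.mem_erase.1 hℓ
    have hℓS' : -ℓ ∈ (Torus.freqBall (Lc / 2)).erase 0 :=
      Finset.mem_erase.2 ⟨neg_ne_zero.2 hℓ0, Torus.neg_mem_freqBall.2 hℓB⟩
    set δ : V2 := Um1 s s' x - Um s s' x with hδ
    set y : V2 := (Torus.memLp_realTrigPoly {ℓ} (fun _ => (2:ℂ) • mFourierCoeff (EuclideanSpace.complexify ∘ ⇑δ) ℓ) 2).toLp _ with hy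
    have hyS : ∀ k', k' ∉ (Torus.freqBall (Lc / 2)).erase 0 → mFourierCoeff (EuclideanSpace.complexify ∘ ⇑y) k' = 0 := by
      intro k' hk'
      rw [hy, fcoeff_pairTest δ hℓ0, if_neg]
      rintro (rfl | rfl)
      · exact hk' hℓ
      · exact hk' hℓS'
    have hdiag := abs_inner_window_sub_le_sum E hL hdes hgain m hV hΛ hlo hhi hc hC hν₀ hSo hSn hΦSn hUm hUm1 Lc hLcN hscale j h1 h3 x y hxS hyS
    refine norm_fcoeff_le_of_diagonal ((Torus.freqBall (Lc / 2)).erase 0) x δ hℓ0 hℓ hℓS' _ ?_ ?_ hdiag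
    · simp only [Torus.latticeVec_neg, norm_neg]
    · -- nonnegativity of the error coefficient
      have hsum : 0 < E.cellVisc (m + 1) + c / E.cellVisc (m + 1) := by positivity
      have hτ0 : 0 ≤ E.a (m + 1) * (s' - s) := mul_nonneg (E.a_pos _).le (by linarith)
      have hR : 0 ≤ 8 * Real.pi ^ 2 * ‖Torus.latticeVec ℓ‖ ^ 2 * (hi * Λ) * (E.cellVisc (m + 1) + c / E.cellVisc (m + 1))
          / (E.N (m + 1) : ℝ) ^ 2 := by
        have : 0 ≤ hi := hlo.le.trans hhi
        positivity
      have hX : 0 ≤ E.cellVisc (m + 1) ^ σ + (‖Torus.latticeVec ℓ‖ * (⌈K / E.cellVisc (m + 1)⌉₊ : ℝ) / E.N (m + 1)) ^ σ := by positivity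
      have hmin : 0 ≤ min 1 (8 * Real.pi ^ 2 * ‖Torus.latticeVec ℓ‖ ^ 2 * (hi * Λ) * (E.cellVisc (m + 1) + c / E.cellVisc (m + 1))
          / (E.N (m + 1) : ℝ) ^ 2 * (E.a (m + 1) * (s' - s))) := le_min zero_le_one (mul_nonneg hR hτ0)
      have hP : 0 ≤ M * W.period / E.cellVisc (m + 1) := by
        have := PermissibleCarrier.period_pos W
        positivity
      have h2 : 0 ≤ Real.sqrt 2 := Real.sqrt_nonneg _
      exact mul_nonneg (by positivity) (mul_nonneg hC (add_nonneg (mul_nonneg (mul_nonneg hC hX) hmin) (mul_nonneg hR hP)))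

end Summit.AnomalousDissipation.AnomalousDissipation.Theorems.SolenoidalFractalHomogenisation.LagrangianStep.FlatWindow

end
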